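import Summits.BirchSwinnertonDyer.BirchSwinnertonDyer.Theorems.KimAtThreeDeepLowerPortDeepTorsionUpperEngine
import Summits.BirchSwinnertonDyer.BirchSwinnertonDyer.Theorems.KimAtThreeDeepLowerPortDeepTorsionCruxes
import Summits.BirchSwinnertonDyer.BirchSwinnertonDyer.Theorems.KimAtThreeShallowEqDeepOffStratumAdditiveDefect
import Summits.BirchSwinnertonDyer.BirchSwinnertonDyer.Theorems.KimAtThreeKolyvaginInputs
import HarnessLib

/-!
# Route `KimAtThreeKolyvagin` (rung W2): the UPPER row at every `t` with the DEEP-guard port, cruxes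
# `DeepUpperAtThreeOffKatoStratum` (19562) / `DeepUpperAtThree` (19076) and the DEEP statement `N11.KimAtThreeDeepPUB`
# BY NAME from PUBLISHED facts + PORT@3-TORS-DEEP — no S24-DEEP flag on any row

Cell `bsd-addord`, seat `bsd-addord-w2-c2` (gen 6; `--supports stmt-BirchSwinnertonDyer-19075`).  Sequel of
`KimAtThreeDeepLowerPortDeepTorsion[Cruxes]` (LOWER) and `…UpperEngine` (acc1's deep UPPER engine from the PINNED
facts); the CORRECTED form of `KimAtThreeDeepLowerPortTorsionUpper` (p482428), whose pinned-guard port over-asks at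
`t ≥ 1` (ERRATUM there; [MR04] App. A Prop. A.2).
HONEST FRAMING. TOOL theorems only (no definition, no named fact, no `sorry`); nothing asserted, nothing booked;
19562 / 19076 / 19075 / 19679 and the obligation node `N11.KimAtThreeDeepPUB` stay OPEN; BSD is not proved by any of
this.  CONDITIONAL on [S24] Thm. 4.4 (1)(2) PINNED, GZK, Poitou–Tate, Carayol and the ONE displayed port text
PORT@3-TORS-DEEP (module docstring of `…PortDeepTorsionCruxes`: acc6's PORT₂ / n1011 (B6) shape, UNLOCKED, class
shift = a torsion-STABLE level `M` of `E(ℚ_{v₃})`, `t`-slot `t`, `∃ e`; FLAG `K22-Thm3.13-PORT@3`).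
* §1 `portE_deep_of_portDeepUnlocked` — the two-depth deep-guard port at `(t, e, M)` gives acc1's single-depth
  one-exponent witnesses at exponent `t` on the deep-guard data (scaling by `3^e`,
  `katoKuriharaWitnessAt_smul_of_witnessAtTwoExp`).
* §2 `deepUpper_row_of_portDeep_tors` — UPPER row `∃ d, ∂^{(∞)}_deep = d ∧ ord₃ #Ш(3) + d ≤ ∂⁽⁰⁾` at ANY tower row,
  ANY `t`, from `hS24 hS24₂ hGZK hPT` + the port (`…UpperEngine.deepUpper_conclusion_of_port_e_deep_pinned` at class
  shift `M`, value exponent `t`).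
* §3 **`deepUpperAtThreeOffKatoStratum_of_sak_of_portDeepOff`** (19562 BY NAME), **`deepUpperAtThree_of_lit_of_portDeepAll`**
  (19076 BY NAME, kim3's optimal-datum reduction), **`kimAtThreeDeepPUB_of_lit_of_portDeepAll`** (the DEEP cell
  statement — Kim's `p = 3` Sha-length formula in the deep-limit currency on EVERY tower row, `t ≥ 1` included —
  BY NAME from [S24](1)(2), GZK, PT, Carayol + PORT@3-TORS-DEEP-ALL).
NET: both halves of the deep statement at EVERY row rest on {PUB} + the one debt class with an MR-faithful port.
References: [MazurRubin2004] App. A Prop. A.2, Thm. 4.4.1, 5.2.12; [Kim2022StructureSelmer] Thm. 1.9 (6), Thm. 3.13;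
[Kim2025RefinedTNC] Thm 1.1, §5; [Sakamoto2024] Thm. 4.4 (1)(2); [Carayol1986]; [EdixhovenManin1991] Prop. 2.
-/

set_option autoImplicit false
-- the Theorems namespace of a single-conjunct summit repeats the summit name by design (D-0017)
set_option linter.dupNamespace false

noncomputable section

open scoped Classical NumberField ContRepresentation
open Function Field NumberField IsDedekindDomain IsDedekindDomain.HeightOneSpectrum WeierstrassCurve
  CongruenceSubgroup
  Literature.NumberTheory.EllipticCurves Literature.NumberTheory.EllipticCurves.ModularForms
  Literature.NumberTheory.EllipticCurves.Rank1Residual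
  Literature.NumberTheory.GaloisRepresentations
  Literature.NumberTheory.GaloisRepresentations.DiscreteGaloisModule Literature.NumberTheory.GaloisCohomology
  Rat.HeightOneSpectrum
  Summit.BirchSwinnertonDyer.Rank1Residual.GaloisImage
  Summit.BirchSwinnertonDyer.Rank1Residual.GaloisImage.Assembly
  Summit.BirchSwinnertonDyer.Rank1Residual.X4

namespace Summit.BirchSwinnertonDyer.BirchSwinnertonDyer.Theorems.KimAtThreeDeepLowerPortDeepTorsionUpper

open Summit.BirchSwinnertonDyer.Rank1Residual.Additive
  Summit.BirchSwinnertonDyer.BirchSwinnertonDyer.Theses.KimAtThreeKolyvagin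
  Summit.BirchSwinnertonDyer.BirchSwinnertonDyer.Theorems.KimAtThreeKolyvaginDefs
  Summit.BirchSwinnertonDyer.BirchSwinnertonDyer.Theorems.KimAtThreeKolyvaginInputs
  Summit.BirchSwinnertonDyer.BirchSwinnertonDyer.Theorems.KimAtThreeKolyvaginUnitLevelOneRungs
  Summit.BirchSwinnertonDyer.BirchSwinnertonDyer.Theorems.KimAtThreeDeepLowerKatoStratumOfFacts
  Summit.BirchSwinnertonDyer.BirchSwinnertonDyer.Theorems.KimAtThreeShallowEqDeepSplitGlueNoStub
  Summit.BirchSwinnertonDyer.BirchSwinnertonDyer.Theorems.KimAtThreeKolyvaginIsogenyCruxes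
  Summit.BirchSwinnertonDyer.BirchSwinnertonDyer.Theorems.KimAtThreeShallowEqDeepOffStratumAdditiveDefect
  Summit.BirchSwinnertonDyer.BirchSwinnertonDyer.Theorems.KimAtThreeDeepLowerOffStratumAdditiveDefectPortTwoExp
  Summit.BirchSwinnertonDyer.BirchSwinnertonDyer.Theorems.KimAtThreeDeepLowerPortDeepTorsionUpperEngine
  Summit.BirchSwinnertonDyer.BirchSwinnertonDyer.Theorems.KimAtThreeDeepLowerPortDeepTorsionCruxes

/-! ### §1 The deep-guard two-depth port feeds acc1's single-depth deep-guard port -/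

/-- **The deep-guard two-depth port at `(t, e, M)` gives n1011's single-depth one-exponent witnesses at exponent
`t` on every deep-guard datum** (`Dk.IsCanonicalTauDatumThreeAtWith W (k + M) k η`): the dictionary at `(k, k)`
with the pinned reduction of `exists_torsionReduction_three`, Kato's families scaled by `3^e` (acc6's
`katoKuriharaWitnessAt_smul_of_witnessAtTwoExp`, general `t`). [cite: Kim2022StructureSelmer, Thm. 3.13 (arXiv p. 17)]
[cite: Kato2004Asterisque, Thm. 12.5 (1)] -/
theorem portE_deep_of_portDeepUnlocked
    (W : WeierstrassCurve ℚ) [W.IsElliptic] [W.IsGloballyMinimal]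
    {N : ℕ} [NeZero N] (D : ModularParametrizationData W N) (t e M : ℕ) (v₃ : HeightOneSpectrum (𝓞 ℚ))
    (η : (q : HeightOneSpectrum (𝓞 ℚ)) → (ZMod (Ideal.absNorm q.asIdeal))ˣ)
    (hPort : ∀ (k k' : ℕ) (Dk : KolyvaginDatum (W.torsionGaloisModule (((3 : ℕ) : ℤ) ^ k * ((3 : ℕ) : ℤ))))
      (Dk' : KolyvaginDatum (W.torsionGaloisModule (((3 : ℕ) : ℤ) ^ k' * ((3 : ℕ) : ℤ))))
      (red : (W.torsionGaloisModule (((3 : ℕ) : ℤ) ^ k' * ((3 : ℕ) : ℤ))).toContRepresentation →ⁱL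
        (W.torsionGaloisModule (((3 : ℕ) : ℤ) ^ k * ((3 : ℕ) : ℤ))).toContRepresentation),
      Dk.IsCanonicalTauDatumThreeAtWith W (k + M) k η → Dk'.IsCanonicalTauDatumThreeAtWith W (k' + M) k' η →
      k ≤ k' →
      (∀ x : geomTorsion W (((3 : ℕ) : ℤ) ^ k' * ((3 : ℕ) : ℤ)),
        ((red x : geomTorsion W (((3 : ℕ) : ℤ) ^ k * ((3 : ℕ) : ℤ))) : geomPoints W) =
          (((3 : ℕ) : ℤ) ^ (k' - k)) • (x : geomPoints W)) →
      ∃ κ Λ κ' κu Λu κu',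
        KatoKuriharaWitnessAtTwoExp W k t e Dk v₃ D κ Λ κ' ∧
        KatoKuriharaWitnessAtTwoExp W k' t e Dk' v₃ D κu Λu κu' ∧
        ∀ d, Dk'.IsLevel d → Dk.IsLevel d →
          galoisCohomology.map red 1 (κu d) = κ d ∧ galoisCohomology.map red 1 (κu' d) = κ' d) :
    ∀ (k : ℕ) (Dk : KolyvaginDatum (W.torsionGaloisModule (((3 : ℕ) : ℤ) ^ k * ((3 : ℕ) : ℤ)))),
      Dk.IsCanonicalTauDatumThreeAtWith W (k + M) k η →
      ∃ (κ : Finset (HeightOneSpectrum (𝓞 ℚ)) →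
            galoisCohomology (W.torsionGaloisModule (((3 : ℕ) : ℤ) ^ k * ((3 : ℕ) : ℤ))) 1)
        (Λ : galoisCohomology ((W.torsionGaloisModule (((3 : ℕ) : ℤ) ^ k * ((3 : ℕ) : ℤ))).toLocal
            (Sum.inr v₃)) 1 →+ ZMod (3 ^ (k + 1)))
        (κ' : Finset (HeightOneSpectrum (𝓞 ℚ)) →
            galoisCohomology (W.torsionGaloisModule (((3 : ℕ) : ℤ) ^ k * ((3 : ℕ) : ℤ))) 1),
        KatoKuriharaWitnessAt W k t Dk v₃ D κ Λ κ' := by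
  intro k Dk hDk
  obtain ⟨red, hred⟩ := exists_torsionReduction_three W k k
  obtain ⟨κ, Λ, κ', -, -, -, hW, -, -⟩ := hPort k k Dk Dk red hDk hDk le_rfl hred
  exact ⟨_, Λ, _, katoKuriharaWitnessAt_smul_of_witnessAtTwoExp W k t e Dk v₃ D κ Λ κ' hW⟩

/-! ### §2 The UPPER row at ANY tower row, ANY `t`, from PUB + the deep-guard port -/

/-- **UPPER row (cruxes 19076 / 19562) at ANY tower row, ANY local `3`-torsion exponent `t` and class shift `M`
in the port: `∃ d, ∂^{(∞)}_deep = d ∧ ord₃ #Ш(3) + d ≤ ∂⁽⁰⁾`** from [S24] (1)(2) PINNED, GZK, Poitou–Tate and the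
deep-guard two-depth port at `(t, e, M)`: acc1's engine re-keyed on the pinned facts
(`…UpperEngine.deepUpper_conclusion_of_port_e_deep_pinned`, class shift `M`, value exponent `t`), fed by §1;
`L(E,1) ≠ 0` from `ord(δ̃) = 0`.  NO S24-DEEP port.  In nature `M = N₀` (torsion-stable level of `E(ℚ₃)`).
[cite: Kim2025RefinedTNC, Thm 1.1, §5] [cite: Kim2022StructureSelmer, Thm. 1.9 (6) and Thm. 3.13]
[cite: MazurRubin2004, Thm. 4.4.1 and App. A Prop. A.2] [cite: Sakamoto2024, Thm. 4.4 (1)(2) (p. 926)] -/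
theorem deepUpper_row_of_portDeep_tors
    (hS24 : Sakamoto2024.kolyvaginSystems_freeRankOne_zmod_three_pow)
    (hS24₂ : Sakamoto2024.kolyvaginSystems_idealOfBasis_eq_fittingIdeal_zmod_three_pow)
    (hGZK : rank_eq_analyticRank_of_analyticRank_le_one) (hPT : poitouTate_selmerStructure_duality ℚ)
    (W : WeierstrassCurve ℚ) [W.IsElliptic] [W.IsGloballyMinimal]
    (htower : ∀ m : ℕ, W.HasSurjectiveModNGaloisRep (3 ^ m : ℕ))
    {N : ℕ} [NeZero N] (D : ModularParametrizationData W N) (t e M : ℕ)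
    (hint : ∀ r : ℚ, ratPlusSymbol D.f r ≠ 0 → 0 ≤ padicValRat 3 (ratPlusSymbol D.f r))
    (hord : kuriharaVanishingOrder W 3 D.f = 0)
    (v₃ : HeightOneSpectrum (𝓞 ℚ)) (hv₃ : ((3 : ℕ) : 𝓞 ℚ) ∈ v₃.asIdeal)
    (η : (q : HeightOneSpectrum (𝓞 ℚ)) → (ZMod (Ideal.absNorm q.asIdeal))ˣ)
    (hη : ∀ q : HeightOneSpectrum (𝓞 ℚ), Subgroup.zpowers (η q) = ⊤)
    (hPort : ∀ (k k' : ℕ) (Dk : KolyvaginDatum (W.torsionGaloisModule (((3 : ℕ) : ℤ) ^ k * ((3 : ℕ) : ℤ))))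
      (Dk' : KolyvaginDatum (W.torsionGaloisModule (((3 : ℕ) : ℤ) ^ k' * ((3 : ℕ) : ℤ))))
      (red : (W.torsionGaloisModule (((3 : ℕ) : ℤ) ^ k' * ((3 : ℕ) : ℤ))).toContRepresentation →ⁱL
        (W.torsionGaloisModule (((3 : ℕ) : ℤ) ^ k * ((3 : ℕ) : ℤ))).toContRepresentation),
      Dk.IsCanonicalTauDatumThreeAtWith W (k + M) k η → Dk'.IsCanonicalTauDatumThreeAtWith W (k' + M) k' η →
      k ≤ k' →
      (∀ x : geomTorsion W (((3 : ℕ) : ℤ) ^ k' * ((3 : ℕ) : ℤ)),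
        ((red x : geomTorsion W (((3 : ℕ) : ℤ) ^ k * ((3 : ℕ) : ℤ))) : geomPoints W) =
          (((3 : ℕ) : ℤ) ^ (k' - k)) • (x : geomPoints W)) →
      ∃ κ Λ κ' κu Λu κu',
        KatoKuriharaWitnessAtTwoExp W k t e Dk v₃ D κ Λ κ' ∧
        KatoKuriharaWitnessAtTwoExp W k' t e Dk' v₃ D κu Λu κu' ∧
        ∀ d, Dk'.IsLevel d → Dk.IsLevel d →
          galoisCohomology.map red 1 (κu d) = κ d ∧ galoisCohomology.map red 1 (κu' d) = κ' d) :
    ∃ dd : ℕ, kuriharaPartialDeepInfty W 3 D.f = dd ∧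
      ((padicValNat 3 (Nat.card (AddCommGroup.primaryComponent W.sha 3)) + dd : ℕ) : ℕ∞) ≤
        kuriharaPartial W 3 D.f 0 := by
  obtain ⟨inv, hperf, hsum, -, hcompl⟩ := hPT 3
  obtain ⟨inv', hperf', hsum', hcompl', hinj'⟩ := exists_localInvariants_three_pow_of_poitouTate hPT
  exact deepUpper_conclusion_of_port_e_deep_pinned hS24 hS24₂ hGZK W htower
    (D.isNewformOf.entireLFunction_one_ne_zero_of_ratPlusSymbol_zero_ne_zero
      (ratPlusSymbol_zero_ne_zero_of_kuriharaVanishingOrder_eq_zero W 3 D.f hord))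
    D hint inv hperf hsum hcompl inv' hperf' hsum' hcompl' hinj' v₃ hv₃ η hη M t
    (portE_deep_of_portDeepUnlocked W D t e M v₃ η hPort)

/-! ### §3 Cruxes 19562 / 19076 and the DEEP statement BY NAME -/

section PortDeepOff

variable
  (hPortDeepOff : ∀ (W₀ : WeierstrassCurve ℚ) [W₀.IsElliptic] [W₀.IsGloballyMinimal],
    (∀ n : ℕ, W₀.HasSurjectiveModNGaloisRep (3 ^ n : ℕ)) →
    ∀ (t M : ℕ), Nat.card {Q : (W₀.baseChange ℚ_[3]).toAffine.Point // (3 : ℕ) • Q = 0} = 3 ^ t →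
    ∀ (v₃ : HeightOneSpectrum (𝓞 ℚ)), ((3 : ℕ) : 𝓞 ℚ) ∈ v₃.asIdeal →
    (∀ Q : (W₀.baseChange (v₃.adicCompletion ℚ)).toAffine.Point, 3 ^ (M + 1) • Q = 0 → 3 ^ M • Q = 0) →
    ∀ (η : (q : HeightOneSpectrum (𝓞 ℚ)) → (ZMod (Ideal.absNorm q.asIdeal))ˣ),
      (∀ q, Subgroup.zpowers (η q) = ⊤) →
    ∀ {N : ℕ} [NeZero N] (P : ModularParametrizationData W₀ N), N = W₀.conductorNorm ℤ →
      (∀ z ∈ P.L.lattice, ∃ w ∈ periodLattice P.f, z = P.c * w) →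
      ¬ ((haveI : Fact (Nat.Prime 3) := ⟨Nat.prime_three⟩; Addv W₀ 3) ∧
          ¬ 3 ∣ (W₀.baseChange ℚ_[3]).localTamagawaNumber ℤ_[3] ∧
          Nat.card {Q : (W₀.baseChange ℚ_[3]).toAffine.Point // (3 : ℕ) • Q = 0} = 1 ∧
          ¬ (3 : ℤ) ∣ P.maninConstant) →
      ∃ e : ℕ, ∀ (k k' : ℕ)
        (Dk : KolyvaginDatum (W₀.torsionGaloisModule (((3 : ℕ) : ℤ) ^ k * ((3 : ℕ) : ℤ))))
        (Dk' : KolyvaginDatum (W₀.torsionGaloisModule (((3 : ℕ) : ℤ) ^ k' * ((3 : ℕ) : ℤ))))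
        (red : (W₀.torsionGaloisModule (((3 : ℕ) : ℤ) ^ k' * ((3 : ℕ) : ℤ))).toContRepresentation →ⁱL
          (W₀.torsionGaloisModule (((3 : ℕ) : ℤ) ^ k * ((3 : ℕ) : ℤ))).toContRepresentation),
        Dk.IsCanonicalTauDatumThreeAtWith W₀ (k + M) k η → Dk'.IsCanonicalTauDatumThreeAtWith W₀ (k' + M) k' η →
        k ≤ k' →
        (∀ x : geomTorsion W₀ (((3 : ℕ) : ℤ) ^ k' * ((3 : ℕ) : ℤ)),
          ((red x : geomTorsion W₀ (((3 : ℕ) : ℤ) ^ k * ((3 : ℕ) : ℤ))) : geomPoints W₀) =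
            (((3 : ℕ) : ℤ) ^ (k' - k)) • (x : geomPoints W₀)) →
        ∃ κ Λ κ' κu Λu κu',
          KatoKuriharaWitnessAtTwoExp W₀ k t e Dk v₃ P κ Λ κ' ∧
          KatoKuriharaWitnessAtTwoExp W₀ k' t e Dk' v₃ P κu Λu κu' ∧
          ∀ d, Dk'.IsLevel d → Dk.IsLevel d →
            galoisCohomology.map red 1 (κu d) = κ d ∧ galoisCohomology.map red 1 (κu' d) = κ' d)

include hPortDeepOff

/-- **Crux 19562 `DeepUpperAtThreeOffKatoStratum` BY NAME — EVERY row, the `t ≥ 1` rows included — ⟸ the route's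
leaves `SakamotoKolyvaginThree` (19558), `RankEqAnalyticRankLeOne` (19921), `PoitouTateSelmerDuality` (19559) ∧
PORT@3-TORS-DEEP-OFF.**  At a row: `t` (`exists_natCard_threeTorsion_eq_three_pow`), `(v₃, η)`
(`exists_place_three_and_generators`), a torsion-STABLE level `M` (`exists_torsion_stable`), the port's `e`, §2.
No S24-DEEP, no TamDiv∞, no (DD), no `ht0`/`hbad` certificate.  CONDITIONAL: does not close the item.
[cite: MazurRubin2004, App. A Prop. A.2 and Thm. 4.4.1] [cite: Kim2025RefinedTNC, Thm 1.1, §5]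
[cite: Kim2022StructureSelmer, Thm. 1.9 (6), Thm. 3.13] [cite: Sakamoto2024, Thm. 4.4 (p. 926)] -/
theorem deepUpperAtThreeOffKatoStratum_of_sak_of_portDeepOff (hSak : SakamotoKolyvaginThree)
    (hGZK : RankEqAnalyticRankLeOne) (hPT : PoitouTateSelmerDuality) : DeepUpperAtThreeOffKatoStratum := by
  intro W₀ _ _ htow _ N _ hN D₀ hopt _ hint hord hoff
  haveI : Fact (Nat.Prime 3) := ⟨Nat.prime_three⟩
  obtain ⟨t, ht⟩ := exists_natCard_threeTorsion_eq_three_pow W₀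
  obtain ⟨v₃, η, hv₃, hη⟩ := exists_place_three_and_generators
  obtain ⟨M, hM⟩ := exists_torsion_stable W₀ 3 v₃
  obtain ⟨e, hPort⟩ := hPortDeepOff W₀ htow t M ht v₃ hv₃ hM η hη D₀ hN hopt hoff
  exact deepUpper_row_of_portDeep_tors hSak.1 hSak.2 hGZK hPT W₀ htow D₀ t e M hint hord v₃ hv₃ η hη hPort

end PortDeepOff

section PortDeepAll

variable
  (hPortDeepAll : ∀ (W₀ : WeierstrassCurve ℚ) [W₀.IsElliptic] [W₀.IsGloballyMinimal],
    (∀ n : ℕ, W₀.HasSurjectiveModNGaloisRep (3 ^ n : ℕ)) →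
    ∀ (t M : ℕ), Nat.card {Q : (W₀.baseChange ℚ_[3]).toAffine.Point // (3 : ℕ) • Q = 0} = 3 ^ t →
    ∀ (v₃ : HeightOneSpectrum (𝓞 ℚ)), ((3 : ℕ) : 𝓞 ℚ) ∈ v₃.asIdeal →
    (∀ Q : (W₀.baseChange (v₃.adicCompletion ℚ)).toAffine.Point, 3 ^ (M + 1) • Q = 0 → 3 ^ M • Q = 0) →
    ∀ (η : (q : HeightOneSpectrum (𝓞 ℚ)) → (ZMod (Ideal.absNorm q.asIdeal))ˣ),
      (∀ q, Subgroup.zpowers (η q) = ⊤) →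
    ∀ {N : ℕ} [NeZero N] (P : ModularParametrizationData W₀ N), N = W₀.conductorNorm ℤ →
      (∀ z ∈ P.L.lattice, ∃ w ∈ periodLattice P.f, z = P.c * w) →
      ∃ e : ℕ, ∀ (k k' : ℕ)
        (Dk : KolyvaginDatum (W₀.torsionGaloisModule (((3 : ℕ) : ℤ) ^ k * ((3 : ℕ) : ℤ))))
        (Dk' : KolyvaginDatum (W₀.torsionGaloisModule (((3 : ℕ) : ℤ) ^ k' * ((3 : ℕ) : ℤ))))
        (red : (W₀.torsionGaloisModule (((3 : ℕ) : ℤ) ^ k' * ((3 : ℕ) : ℤ))).toContRepresentation →ⁱL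
          (W₀.torsionGaloisModule (((3 : ℕ) : ℤ) ^ k * ((3 : ℕ) : ℤ))).toContRepresentation),
        Dk.IsCanonicalTauDatumThreeAtWith W₀ (k + M) k η → Dk'.IsCanonicalTauDatumThreeAtWith W₀ (k' + M) k' η →
        k ≤ k' →
        (∀ x : geomTorsion W₀ (((3 : ℕ) : ℤ) ^ k' * ((3 : ℕ) : ℤ)),
          ((red x : geomTorsion W₀ (((3 : ℕ) : ℤ) ^ k * ((3 : ℕ) : ℤ))) : geomPoints W₀) =
            (((3 : ℕ) : ℤ) ^ (k' - k)) • (x : geomPoints W₀)) →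
        ∃ κ Λ κ' κu Λu κu',
          KatoKuriharaWitnessAtTwoExp W₀ k t e Dk v₃ P κ Λ κ' ∧
          KatoKuriharaWitnessAtTwoExp W₀ k' t e Dk' v₃ P κu Λu κu' ∧
          ∀ d, Dk'.IsLevel d → Dk.IsLevel d →
            galoisCohomology.map red 1 (κu d) = κ d ∧ galoisCohomology.map red 1 (κu' d) = κ' d)

include hPortDeepAll

/-- **Crux 19076 `DeepUpperAtThree` BY NAME ⟸ [S24] Thm. 4.4 (1)(2) PINNED ∧ GZK ∧ Poitou–Tate ∧ Carayol ∧
PORT@3-TORS-DEEP-ALL** — every row, `t ≥ 1` included; no Kato-stratum split, no stub child 19561, no PORT″, no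
S24-DEEP: kim3 g9's `deepUpperAtThree_of_forall_optimalDatum_atConductor`, then §2 at the row's `t`, a stable `M`,
`(v₃, η)`, the port's `e`.  CONDITIONAL: does not close the item. [cite: MazurRubin2004, App. A Prop. A.2 and Thm. 4.4.1]
[cite: Kim2025RefinedTNC, Thm 1.1, §5] [cite: Sakamoto2024, Thm. 4.4 (p. 926)] [cite: Carayol1986]
[cite: EdixhovenManin1991, Prop. 2] -/
theorem deepUpperAtThree_of_lit_of_portDeepAll
    (hS24 : Sakamoto2024.kolyvaginSystems_freeRankOne_zmod_three_pow)
    (hS24₂ : Sakamoto2024.kolyvaginSystems_idealOfBasis_eq_fittingIdeal_zmod_three_pow)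
    (hGZK : rank_eq_analyticRank_of_analyticRank_le_one) (hPT : poitouTate_selmerStructure_duality ℚ)
    (hlev : ∀ (N : ℕ) [NeZero N], IsNewformOf.level_eq_conductorNorm (N := N)) : DeepUpperAtThree := by
  refine deepUpperAtThree_of_forall_optimalDatum_atConductor hlev ?_
  intro W₀ _ _ htow _ N _ hN D₀ hopt _ hint hord
  haveI : Fact (Nat.Prime 3) := ⟨Nat.prime_three⟩
  obtain ⟨t, ht⟩ := exists_natCard_threeTorsion_eq_three_pow W₀
  obtain ⟨v₃, η, hv₃, hη⟩ := exists_place_three_and_generators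
  obtain ⟨M, hM⟩ := exists_torsion_stable W₀ 3 v₃
  obtain ⟨e, hPort⟩ := hPortDeepAll W₀ htow t M ht v₃ hv₃ hM η hη D₀ hN hopt
  exact deepUpper_row_of_portDeep_tors hS24 hS24₂ hGZK hPT W₀ htow D₀ t e M hint hord v₃ hv₃ η hη hPort

/-- **The cell's DEEP statement `N11.KimAtThreeDeepPUB` BY NAME ⟸ [S24] Thm. 4.4 (1)(2) PINNED ∧ GZK ∧ Poitou–Tate ∧
Carayol ∧ PORT@3-TORS-DEEP-ALL** — Kim's `p = 3` Sha-length formula in the deep-limit currency, `∂^{(∞)}_deep(δ̃) =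
d ∈ ℕ` and `∂⁽⁰⁾(δ̃) = ord₃ #Ш(E)(3) + d`, on EVERY `3`-adic-tower row of analytic rank `0` (NO `E(ℚ₃)[3]` binder):
`kimAtThreeDeepPUB_iff_lower_and_upper` on `…PortDeepTorsionCruxes.deepLowerAtThree_of_lit_of_portDeepAll` and
`deepUpperAtThree_of_lit_of_portDeepAll`.  The port is the MR-faithful deep-guard text (stable level `M`), UNLIKE the
over-asking pinned-guard port of `KimAtThreeDeepLowerPortTorsionUpper.kimAtThreeDeepPUB_of_pub_of_portTorsAll`
(ERRATUM there).  CONDITIONAL: does not discharge the obligation node; nothing booked.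
[cite: Kim2025RefinedTNC, Thm 1.1] [cite: Kim2022StructureSelmer, Thm. 1.9 (6), Thm. 3.13]
[cite: MazurRubin2004, App. A Prop. A.2, Thm. 4.4.1 and Thm. 5.2.12] [cite: Sakamoto2024, Thm. 4.4 (p. 926)] [cite: Carayol1986] -/
theorem kimAtThreeDeepPUB_of_lit_of_portDeepAll
    (hS24 : Sakamoto2024.kolyvaginSystems_freeRankOne_zmod_three_pow)
    (hS24₂ : Sakamoto2024.kolyvaginSystems_idealOfBasis_eq_fittingIdeal_zmod_three_pow)
    (hGZK : rank_eq_analyticRank_of_analyticRank_le_one) (hPT : poitouTate_selmerStructure_duality ℚ)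
    (hlev : ∀ (N : ℕ) [NeZero N], IsNewformOf.level_eq_conductorNorm (N := N)) : N11.KimAtThreeDeepPUB :=
  kimAtThreeDeepPUB_iff_lower_and_upper.mpr
    ⟨KimAtThreeDeepLowerPortDeepTorsionCruxes.deepLowerAtThree_of_lit_of_portDeepAll hPortDeepAll hS24 hS24₂ hGZK
        hPT hlev,
      deepUpperAtThree_of_lit_of_portDeepAll hPortDeepAll hS24 hS24₂ hGZK hPT hlev⟩

end PortDeepAll

end Summit.BirchSwinnertonDyer.BirchSwinnertonDyer.Theorems.KimAtThreeDeepLowerPortDeepTorsionUpper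

end
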